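import Mathlib.Analysis.SpecialFunctions.Trigonometric.Deriv
import Mathlib.MeasureTheory.Integral.IntervalIntegral.Basic
import Mathlib.Analysis.SpecialFunctions.Pow.Real
import Mathlib.Topology.Algebra.InfiniteSum.Real
import Mathlib.Analysis.Asymptotics.Defs
import Mathlib.Analysis.Calculus.ContDiff.Defs
import HarnessLib

-- provenance: harness21/H21/H21/Prelude/Sobolev/BesselJ.lean @ 5da076a (interim HEAD d8f2665); M5 mechanical rewrite
/-!
# Bessel functions of the first kind of integer order

Trunk: Sobolev (prelude item C11, notion `bessel_J`).

We define the Bessel function of the first kind `J_n` of non-negative integer order `n : ℕ`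
by its power series
`J_n(x) = ∑_{k ≥ 0} (-1)^k / (k! (k+n)!) (x/2)^(2k+n)`
(Watson, *A Treatise on the Theory of Bessel Functions*, §2.1–2.2; DLMF 10.2.2), and state
the standard API: convergence of the series, values at `0`, Bessel's integral
`J_n(x) = π⁻¹ ∫₀^π cos(nθ - x sin θ) dθ` (DLMF 10.9.2), smoothness, the bounds `|J_0| ≤ 1`,
`|J_n| ≤ 1/√2` (`n ≥ 1`, DLMF 10.14.1), `J_0' = -J_1` (DLMF 10.6.3), the three-term
recurrence (DLMF 10.6.1) and the decay `J_n(x) = O(x^{-1/2})` as `x → +∞` (DLMF 10.17.3),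
which is what makes the Lieb–Wu integrands integrable.

## Mathlib

Mathlib (at the pinned commit) has no Bessel functions: searching for `bessel` only finds
Bessel's inequality and the Bessel potential `besselPotential` on tempered distributions.
Everything else used (`tsum`, `HasSum`, `Nat.factorial`, `intervalIntegral`, `Real.cos`,
`HasDerivAt`, `ContDiff`, `Asymptotics.IsBigO`) is Mathlib's.

## Design choices

* Namespace `Literature`, names `Literature.Analysis.FunctionSpaces.besselJ`, `Literature.Analysis.FunctionSpaces.besselJTerm` (not `Real.besselJ`: the first explicit
  argument is the order `n : ℕ`, so dot notation on `ℝ` would be useless, and an `Literature.Real`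
  namespace would interact badly with `open Real`).
* Integer (indeed natural) order only: this suffices for the Hubbard/Lieb–Wu statements; real
  order `ν` would need `x ^ ν` and the Gamma function and is deferred.
* The recurrence is stated at order `n + 1` (`J_n + J_{n+2} = (2(n+1)/x) J_{n+1}`) to avoid
  natural-number subtraction.
-/

noncomputable section

open scoped Topology
open Filter Asymptotics Real

namespace Literature.Analysis.FunctionSpaces

/-- The `k`-th term of the power series of the Bessel function `J_n` at `x`:
`(-1)^k / (k! (k+n)!) · (x/2)^(2k+n)` (Watson §2.1 (8); DLMF 10.2.2 with `ν = n`). [folklore] -/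
def besselJTerm (n : ℕ) (x : ℝ) (k : ℕ) : ℝ :=
  (-1 : ℝ) ^ k / ((k.factorial : ℝ) * ((k + n).factorial : ℝ)) * (x / 2) ^ (2 * k + n)

/-- The Bessel function of the first kind of order `n : ℕ`,
`J_n(x) = ∑_{k ≥ 0} (-1)^k / (k! (k+n)!) · (x/2)^(2k+n)` (Watson §2.1 (8); DLMF 10.2.2).
Defined as a `tsum`; the series is absolutely convergent for every real `x`
(`summable_besselJTerm`), so no junk value arises. [folklore] -/
def besselJ (n : ℕ) (x : ℝ) : ℝ :=
  ∑' k, besselJTerm n x k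

/-- The `k = 0` term of the Bessel series is `(x/2)^n / n!` (Watson §2.1 (8)). [folklore] -/
@[simp]
theorem besselJTerm_zero_right (n : ℕ) (x : ℝ) :
    besselJTerm n x 0 = (x / 2) ^ n / (n.factorial : ℝ) := by
  simp [besselJTerm, div_eq_inv_mul, mul_comm]

/-- The Bessel series converges (absolutely) for every real `x` (Watson §2.11; it is dominated
by the exponential series). [cite: Watson1944, §2.11] -/
def summable_besselJTerm : Prop :=
  ∀ (n : ℕ) (x : ℝ),
    Summable (besselJTerm n x)

/-- The Bessel series sums to `J_n(x)` (Watson §2.1 (8); DLMF 10.2.2). [folklore] -/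
def hasSum_besselJ : Prop :=
  ∀ (n : ℕ) (x : ℝ),
    HasSum (besselJTerm n x) (besselJ n x)

/- interim proof relied on results that are now named facts (D-0014); demoted to a fact by the M5 import, proof preserved:
:=
  (summable_besselJTerm n x).hasSum
-/

/-- `J_0(0) = 1` (Watson §2.1; DLMF 10.2.2). [folklore] -/
theorem besselJ_zero_zero : besselJ 0 0 = 1 := by
  rw [besselJ, tsum_eq_single 0]
  · simp
  · intro k hk
    simp [besselJTerm, hk]

/-- `J_{n+1}(0) = 0` (Watson §2.1; DLMF 10.2.2). [folklore] -/
theorem besselJ_succ_apply_zero (n : ℕ) : besselJ (n + 1) 0 = 0 := by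
  simp [besselJ, besselJTerm]

/-- **Bessel's integral**: for `n : ℕ` and real `x`,
`J_n(x) = π⁻¹ ∫₀^π cos(nθ - x sin θ) dθ` (Watson §2.2 (1); DLMF 10.9.2). [cite: Watson1944, §2.2 (1); DLMF 10.9.2] -/
def besselJ_eq_integral_cos : Prop :=
  ∀ (n : ℕ) (x : ℝ),
    besselJ n x = π⁻¹ * ∫ θ in (0 : ℝ)..π, cos (n * θ - x * sin θ)

/-- `J_n` is smooth on `ℝ` (it is the sum of an everywhere-convergent power series;
Watson §2.11). [cite: Watson1944, §2.11] -/
def contDiff_besselJ : Prop :=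
  ∀ (n : ℕ) {m : WithTop ℕ∞},
    ContDiff ℝ m (besselJ n)

/-- `J_n` is continuous on `ℝ` (Watson §2.11). [folklore] -/
def continuous_besselJ : Prop :=
  ∀ (n : ℕ),
    Continuous (besselJ n)

/- interim proof relied on results that are now named facts (D-0014); demoted to a fact by the M5 import, proof preserved:
:=
  (contDiff_besselJ n (m := 0)).continuous
-/

/-- `|J_0(x)| ≤ 1` for all real `x` (DLMF 10.14.1; immediate from Bessel's integral). [cite: DLMF, 10.14.1] -/
def abs_besselJ_zero_le_one : Prop :=
  ∀ (x : ℝ),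
    |besselJ 0 x| ≤ 1

/-- `|J_n(x)| ≤ 1/√2` for `n ≥ 1` and all real `x` (DLMF 10.14.1). [cite: DLMF, 10.14.1] -/
def abs_besselJ_succ_le : Prop :=
  ∀ (n : ℕ) (x : ℝ),
    |besselJ (n + 1) x| ≤ 1 / √2

/-- `|J_n(x)| ≤ 1` for all `n : ℕ` and real `x` (DLMF 10.14.1). [cite: DLMF, 10.14.1] -/
def abs_besselJ_le_one : Prop :=
  ∀ (n : ℕ) (x : ℝ),
    |besselJ n x| ≤ 1

/-- `J_0' = -J_1` (Watson §2.12 (5); DLMF 10.6.3 with `ν = 0`). [cite: Watson1944, §2.12 (5); DLMF 10.6.3] -/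
def hasDerivAt_besselJ_zero : Prop :=
  ∀ (x : ℝ),
    HasDerivAt (besselJ 0) (-besselJ 1 x) x

/-- The three-term recurrence `J_{ν-1}(x) + J_{ν+1}(x) = (2ν/x) J_ν(x)` (Watson §2.12 (1);
DLMF 10.6.1), stated at `ν = n + 1` to avoid natural-number subtraction:
`J_n(x) + J_{n+2}(x) = (2(n+1)/x) J_{n+1}(x)` for `x ≠ 0`. [cite: Watson1944, §2.12 (1); DLMF 10.6.1] -/
def besselJ_recurrence : Prop :=
  ∀ (n : ℕ) {x : ℝ} (hx : x ≠ 0),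
    besselJ n x + besselJ (n + 2) x = 2 * (n + 1) / x * besselJ (n + 1) x

/-- Decay at infinity: `J_n(x) = O(x^{-1/2})` as `x → +∞` (Watson §7.21; DLMF 10.17.3). This is
the estimate that makes the Lieb–Wu integrands `J_0 J_1 / ω`, `J_1 / ω` integrable on `(0, ∞)`. [cite: Watson1944, §7.21; DLMF 10.17.3] -/
def besselJ_isBigO_rpow_neg_half : Prop :=
  ∀ (n : ℕ),
    besselJ n =O[atTop] fun x : ℝ => x ^ (-(1 / 2 : ℝ))

end Literature.Analysis.FunctionSpaces
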